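import Summits.SmoothPoincare4.SmoothPoincare4.Theorems.ConvexBisectionAcyclicBisectionExistsBeltCoreTwistingLoop
import HarnessLib

/-!
# Hgap ▸ part B (page twisting of the straightened dual framed knot), brick G2-1 (tube side):
# the first-order variation of the page angle along the fibres of a tube around a page curve
(wave 6, crux stmt-SmoothPoincare4-10508, line `modp-braid-orbits`, stub `stub_T3_dualPresentation` (T3)
▸ node `Hgap` ▸ part B `helper_Hgap_twisting`; registered sub-goal `helper_pageSlope_fibreDeriv`)

Near the belt circle `B` of the `j`-th handle the boundary open book of `X` is, on glued points,
`Θ(b) = (page angle of) w (h̄_j (α b))` (`G2-REPORT.md`): the sphere point `b = (r v, √(1-r²) u)`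
(`r > 0`) is glued to the tube point of core angle `v` and fibre vector `r u`, i.e. to
`f♭ (v, r u)`, `f♭ = (h j).boundaryTube`.  So the first-order structure of `Θ` at `B` is the FIBRE
DERIVATIVE at `0` of the page angle along the tube `f♭`, which this file computes for ANY map `F`
into `ℝ⁴ = ℂ²` through a point `q` of the flat page of direction `c` (`w q = c/2`, `‖c‖ = 1`):

* §1 the **page slope** `S_c(z) = Im (c̄ z) / Re (c̄ z)` (the tangent of the page angle measured from
  the direction `c`; invariant under POSITIVE RESCALING of `z` — the page clause `w (Ψ y) = c · w a`,
  `c > 0`, and the fibredness `w ∘ R_t = r · w` of the straightening only rescale — and smooth near the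
  ray `ℝ₊ c`, so no argument function is needed): `S_c (t z) = S_c z` (`pageSlope_smul`),
  `S_c (c/2) = 0`;
* §2 **the fibre derivative** (`hasFDerivAt_pageSlope_comp`, registered `helper_pageSlope_fibreDeriv`):
  if `F` has derivative `D` at `m₀` and `w (F m₀) = c/2` then `m ↦ S_c (w (F m))` has derivative
  `m ↦ 4 ‖dΦ_q‖² ⟪D m, n(q)⟫ = ⟪D m, n(q)⟫ / ‖n(q)‖²` at `m₀` (`n = horizNormal`, the positive page
  normal; `⟪V, n⟫ = Im (w̄ dΦ V)/‖dΦ‖²`, `inner_horizNormal`), and `‖n(q)‖² = 1 / (4 ‖dΦ_q‖²)`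
  (`norm_horizNormal_sq_of_page`);
* §3 **in a page frame** (`pageSlope_coeff_of_pageFrame`): for `V = a · iT + b · rot(q) + e · T` with
  `T` a page tangent (`dΦ_q T = 0`), `4 ‖dΦ_q‖² ⟪V, n(q)⟫ = b` — so for a tube whose fibre derivative
  read through Z4's page tube is `m ↦ (A m)₀ r iK' + (A m)₁ κ rot`, the fibre derivative of the page
  slope is EXACTLY `m ↦ κ (A m)₁`, the second ROW of the transition matrix `A` (`frameCol`,
  `CircleTube.fibreDeriv`): the data `ℓ_F = κ⁻¹…`-free input of the winding count
  `helper_wind_beltCount` (`…HgapTwistWind.lean`).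

Everything is proved; no named facts, no `sorry`.  References: J. B. Etnyre, T. Fuller, IMRN 2006,
Thm. 1 (proof, p. 8) [EtnyreFuller2006]; A. A. Kosinski, *Differential Manifolds* (1993), III (3.1)
[Kosinski1993].
-/

noncomputable section

set_option linter.dupNamespace false

open scoped Manifold ContDiff Topology ComplexConjugate
open Set Function Complex
open Literature.Topology.FourManifolds Literature.Topology.FourManifolds.LefschetzBase

namespace Summit.SmoothPoincare4.SmoothPoincare4.Theorems.AcyclicBisectionExists.ModpBraidOrbits

variable {g : ℕ}

/-! ## §1 The page slope measured from a unit direction -/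

/-- **Scale invariance of the page slope**: `Im (c̄ (t z)) / Re (c̄ (t z)) = Im (c̄ z) / Re (c̄ z)` for real
`t ≠ 0`. [folklore] -/
theorem pageSlope_smul (c z : ℂ) {t : ℝ} (ht : t ≠ 0) :
    (conj c * ((t : ℂ) * z)).im / (conj c * ((t : ℂ) * z)).re = (conj c * z).im / (conj c * z).re := by
  have e1 : (conj c * ((t : ℂ) * z)).im = t * (conj c * z).im := by
    simp only [Complex.mul_im, Complex.mul_re, Complex.ofReal_re, Complex.ofReal_im, zero_mul,
      sub_zero, add_zero]
    ring
  have e2 : (conj c * ((t : ℂ) * z)).re = t * (conj c * z).re := by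
    simp only [Complex.mul_re, Complex.mul_im, Complex.ofReal_re, Complex.ofReal_im, zero_mul,
      sub_zero, add_zero]
    ring
  rw [e1, e2, mul_div_mul_left _ _ ht]

/-- At the page direction itself the slope data are `Re (c̄ · c/2) = 1/2`, `Im (c̄ · c/2) = 0`.
[folklore] -/
theorem conj_mul_half_self {c : ℂ} (hc : ‖c‖ = 1) :
    (conj c * (c / 2)).re = 1 / 2 ∧ (conj c * (c / 2)).im = 0 := by
  have e : conj c * (c / 2) = ((Complex.normSq c : ℝ) : ℂ) / 2 := by
    rw [Complex.normSq_eq_conj_mul_self]; ring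
  have hn : Complex.normSq c = 1 := by
    rw [Complex.normSq_eq_norm_sq, hc, one_pow]
  rw [e, hn]
  norm_num

/-- A point with `w = c/2`, `‖c‖ = 1`, is not the origin (`w 0 = -1`). [folklore] -/
theorem ne_zero_of_w_eq_half {q : EuclideanSpace ℝ (Fin 4)} {c : ℂ} (hc : ‖c‖ = 1)
    (hw : w g q = c / 2) : q ≠ 0 := by
  rintro rfl
  have h0 : w g 0 = -1 := by
    simp only [w, Phi, cx_zero, cy_zero]
    rw [zero_pow two_ne_zero, zero_pow (by omega), sub_zero, zero_sub]
  rw [h0] at hw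
  have : ‖c‖ = 2 := by
    have e : c = -2 := by linear_combination -2 * hw
    rw [e, norm_neg]; norm_num
  rw [hc] at this
  norm_num at this

/-- **`‖n(q)‖² = ‖w(q)‖² / ‖dΦ_q‖²`** for the horizontal normal `n = (i w/‖dΦ‖²)(ā, b̄)`, off the origin.
[folklore] -/
theorem norm_horizNormal_sq {q : EuclideanSpace ℝ (Fin 4)} (hq : q ≠ 0) :
    ‖horizNormal g q‖ ^ 2 = ‖w g q‖ ^ 2 / (‖dPhiX g q‖ ^ 2 + ‖dPhiY q‖ ^ 2) := by
  rw [← real_inner_self_eq_norm_sq, inner_horizNormal, dPhi_horizNormal hq]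
  congr 1
  have e : conj (w g q) * (Complex.I * w g q) = Complex.I * (w g q * conj (w g q)) := by ring
  rw [e, Complex.mul_conj, Complex.I_mul_im, Complex.ofReal_re, Complex.normSq_eq_norm_sq]

/-- On a flat page (`w q = c/2`, `‖c‖ = 1`): `‖n(q)‖² · 4 ‖dΦ_q‖² = 1`. [folklore] -/
theorem norm_horizNormal_sq_of_page {q : EuclideanSpace ℝ (Fin 4)} {c : ℂ} (hc : ‖c‖ = 1)
    (hw : w g q = c / 2) :
    ‖horizNormal g q‖ ^ 2 * (4 * (‖dPhiX g q‖ ^ 2 + ‖dPhiY q‖ ^ 2)) = 1 := by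
  have hq : q ≠ 0 := ne_zero_of_w_eq_half hc hw
  have hN : ‖dPhiX g q‖ ^ 2 + ‖dPhiY q‖ ^ 2 ≠ 0 := normSq_dPhi_ne_zero hq
  rw [norm_horizNormal_sq hq, hw, norm_div, hc]
  field_simp
  norm_num

/-! ## §2 The fibre derivative of the page slope -/

/-- **`⟪V, n(q)⟫ · 4 ‖dΦ_q‖² = 2 Im (c̄ dΦ_q V)` on the page of direction `c`** (`w q = c/2`).
[folklore] -/
theorem inner_horizNormal_of_page {q : EuclideanSpace ℝ (Fin 4)} {c : ℂ} (hc : ‖c‖ = 1)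
    (hw : w g q = c / 2) (V : EuclideanSpace ℝ (Fin 4)) :
    4 * (‖dPhiX g q‖ ^ 2 + ‖dPhiY q‖ ^ 2) * inner ℝ V (horizNormal g q) =
      2 * (conj c * (dPhiX g q * cx V + dPhiY q * cy V)).im := by
  have hq : q ≠ 0 := ne_zero_of_w_eq_half hc hw
  have hN : ‖dPhiX g q‖ ^ 2 + ‖dPhiY q‖ ^ 2 ≠ 0 := normSq_dPhi_ne_zero hq
  rw [inner_horizNormal, hw, mul_div_assoc', div_eq_iff hN, map_div₀, Complex.conj_ofNat]
  have e : (conj c / 2 * (dPhiX g q * cx V + dPhiY q * cy V)).im =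
      (conj c * (dPhiX g q * cx V + dPhiY q * cy V)).im / 2 := by
    rw [div_mul_eq_mul_div, Complex.div_ofNat_im]
  rw [e]
  ring

/-- **The fibre derivative of the page slope** (brick G2-1, tube side).  Let `F : E → ℝ⁴` have
derivative `D` at `m₀` with `w (F m₀) = c/2`, `‖c‖ = 1` (a map through a point `q = F m₀` of the flat
page of direction `c`; in the application the fibre map `m ↦ f♭ (v, m)` of the boundary tube of the
`j`-th handle at a core point).  Then the page slope `m ↦ Im (c̄ w (F m)) / Re (c̄ w (F m))` has
derivative `m ↦ 4 ‖dΦ_q‖² ⟪D m, n(q)⟫` at `m₀` (`= ⟪D m, n(q)⟫ / ‖n(q)‖²`,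
`norm_horizNormal_sq_of_page`). [cite: EtnyreFuller2006, Thm. 1 (proof, p. 8)] -/
theorem hasFDerivAt_pageSlope_comp {E : Type*} [NormedAddCommGroup E] [NormedSpace ℝ E]
    {F : E → EuclideanSpace ℝ (Fin 4)} {D : E →L[ℝ] EuclideanSpace ℝ (Fin 4)} {m₀ : E}
    (hF : HasFDerivAt F D m₀) {c : ℂ} (hc : ‖c‖ = 1) (hw : w g (F m₀) = c / 2) :
    HasFDerivAt (fun m => (conj c * w g (F m)).im / (conj c * w g (F m)).re)
      ((4 * (‖dPhiX g (F m₀)‖ ^ 2 + ‖dPhiY (F m₀)‖ ^ 2)) •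
        ((innerSL ℝ (horizNormal g (F m₀))).comp D)) m₀ := by
  -- the complex function `W m = c̄ · w (F m)` and its derivative
  have hwd : HasFDerivAt (w g) (fderiv ℝ (w g) (F m₀)) (F m₀) :=
    (((contDiff_w g).differentiable (by simp)) (F m₀)).hasFDerivAt
  have hW : HasFDerivAt (fun m => conj c * w g (F m)) (conj c • ((fderiv ℝ (w g) (F m₀)).comp D)) m₀ :=
    (hwd.comp m₀ hF).const_mul (conj c)
  have hRe : HasFDerivAt (fun m => (conj c * w g (F m)).re)
      (Complex.reCLM.comp (conj c • ((fderiv ℝ (w g) (F m₀)).comp D))) m₀ :=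
    Complex.reCLM.hasFDerivAt.comp m₀ hW
  have hIm : HasFDerivAt (fun m => (conj c * w g (F m)).im)
      (Complex.imCLM.comp (conj c • ((fderiv ℝ (w g) (F m₀)).comp D))) m₀ :=
    Complex.imCLM.hasFDerivAt.comp m₀ hW
  obtain ⟨hre0, him0⟩ := conj_mul_half_self hc
  have hRe0 : (conj c * w g (F m₀)).re = 1 / 2 := by rw [hw]; exact hre0
  have hIm0 : (conj c * w g (F m₀)).im = 0 := by rw [hw]; exact him0
  have hne : (conj c * w g (F m₀)).re ≠ 0 := by rw [hRe0]; norm_num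
  -- the quotient `Im / Re = Im · Re⁻¹`
  have hInv := (hasFDerivAt_inv hne).comp m₀ hRe
  have hprod := hIm.mul hInv
  have hfun : (fun m => (conj c * w g (F m)).im / (conj c * w g (F m)).re) =
      fun m => (conj c * w g (F m)).im * ((fun x : ℝ => x⁻¹) ∘ fun m => (conj c * w g (F m)).re) m := by
    funext m; rw [div_eq_mul_inv]; rfl
  rw [hfun]
  refine hprod.congr_fderiv ?_
  -- compare the two linear maps
  ext m
  rw [hIm0, zero_smul, zero_add, Function.comp_apply, hRe0]
  simp only [FunLike.coe_smul, Pi.smul_apply, ContinuousLinearMap.coe_comp,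
    Function.comp_apply, Complex.imCLM_apply, innerSL_apply_apply, smul_eq_mul]
  rw [real_inner_comm, inner_horizNormal_of_page hc hw, ← fderiv_w_apply]
  norm_num

/-- **Sub-goal `helper_pageSlope_fibreDeriv` of stub `stub_T3_dualPresentation`** (T3 ▸ node `Hgap` ▸
part B `helper_Hgap_twisting`, brick G2-1 tube side; wave 6, lead c5): the page slope
`Im (c̄ w ∘ F) / Re (c̄ w ∘ F)` through a point of the flat page of direction `c` has derivative
`m ↦ 4 ‖dΦ‖² ⟪D m, n⟫`. [cite: EtnyreFuller2006, Thm. 1 (proof, p. 8)] -/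
theorem helper_pageSlope_fibreDeriv : ∀ (g : ℕ) (F : EuclideanSpace ℝ (Fin 2) → EuclideanSpace ℝ (Fin 4)) (D : EuclideanSpace ℝ (Fin 2) →L[ℝ] EuclideanSpace ℝ (Fin 4)) (m₀ : EuclideanSpace ℝ (Fin 2)) (c : ℂ), HasFDerivAt F D m₀ → ‖c‖ = 1 → Literature.Topology.FourManifolds.LefschetzBase.w g (F m₀) = c / 2 → HasFDerivAt (fun m => ((starRingEnd ℂ) c * Literature.Topology.FourManifolds.LefschetzBase.w g (F m)).im / ((starRingEnd ℂ) c * Literature.Topology.FourManifolds.LefschetzBase.w g (F m)).re) ((4 * (‖Literature.Topology.FourManifolds.LefschetzBase.dPhiX g (F m₀)‖ ^ 2 + ‖Literature.Topology.FourManifolds.LefschetzBase.dPhiY (F m₀)‖ ^ 2)) • ((innerSL ℝ (Literature.Topology.FourManifolds.LefschetzBase.horizNormal g (F m₀))).comp D)) m₀ :=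
  fun _ _ _ _ _ hF hc hw => hasFDerivAt_pageSlope_comp hF hc hw

/-- **The fibre derivative of the page slope along a curve**: for `γ : ℝ → ℝ⁴` with velocity `Y` at
`s₀` and `w (γ s₀) = c/2`, the page slope along `γ` has derivative `4 ‖dΦ‖² ⟪Y, n⟫` at `s₀` (the form
used for the radial arcs `r ↦ f♭ (v, r u)` glued to the sphere arcs `r ↦ (r v, √(1-r²) u)` through the
belt circle). [cite: EtnyreFuller2006, Thm. 1 (proof, p. 8)] -/
theorem hasDerivAt_pageSlope_comp {γ : ℝ → EuclideanSpace ℝ (Fin 4)} {Y : EuclideanSpace ℝ (Fin 4)} {s₀ : ℝ}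
    (hγ : HasDerivAt γ Y s₀) {c : ℂ} (hc : ‖c‖ = 1) (hw : w g (γ s₀) = c / 2) :
    HasDerivAt (fun s => (conj c * w g (γ s)).im / (conj c * w g (γ s)).re)
      (4 * (‖dPhiX g (γ s₀)‖ ^ 2 + ‖dPhiY (γ s₀)‖ ^ 2) * inner ℝ Y (horizNormal g (γ s₀))) s₀ := by
  have h := (hasFDerivAt_pageSlope_comp (g := g) hγ.hasFDerivAt hc hw).hasDerivAt
  refine h.congr_deriv ?_
  simp only [FunLike.coe_smul, Pi.smul_apply, ContinuousLinearMap.coe_comp,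
    Function.comp_apply, innerSL_apply_apply, smul_eq_mul,
    ContinuousLinearMap.toSpanSingleton_apply, one_smul]
  rw [real_inner_comm]

/-! ## §3 The fibre derivative in a page frame -/

/-- **The page slope sees only the `rot`-component.**  On the flat page of direction `c` through `q`,
for a page tangent `T` (`dΦ_q T = 0`): `4 ‖dΦ_q‖² ⟪a · iT + b · rot(q) + e · T, n(q)⟫ = b` — the in-page
directions `T`, `iT` are `⟪·, n⟫`-null and `⟪rot, n⟫ = ‖w‖²/‖dΦ‖² = 1/(4‖dΦ‖²)`.  Hence, for a tube
`f♭` whose fibre derivative read through a page tube is `m ↦ (A m)₀ r iK' + (A m)₁ κ rot`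
(`helper_belt_frameCol_ambient`, Z4's fibre-derivative clause), the fibre derivative of the page slope
is `m ↦ κ (A m)₁`. [cite: Kosinski1993, III (3.1)] -/
theorem pageSlope_coeff_of_pageFrame {q T : EuclideanSpace ℝ (Fin 4)} {c : ℂ} (hc : ‖c‖ = 1)
    (hw : w g q = c / 2) (hflat : ‖cx q‖ ^ 2 < 4) (hT : dPhiX g q * cx T + dPhiY q * cy T = 0)
    (a b e : ℝ) :
    4 * (‖dPhiX g q‖ ^ 2 + ‖dPhiY q‖ ^ 2) *
        inner ℝ (a • cplxJ T + b • rotField g q + e • T) (horizNormal g q) = b := by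
  have hq : q ≠ 0 := ne_zero_of_w_eq_half hc hw
  have hρ : rho g q ≤ 3 / 10 := by
    rw [rho, eta_of_le hflat.le, hw, norm_div, hc]
    norm_num
  have h1 : inner ℝ (cplxJ T) (horizNormal g q) = 0 := inner_cplxJ_horizNormal_eq_zero hT
  have h2 : inner ℝ T (horizNormal g q) = 0 := by
    rw [inner_horizNormal, hT, mul_zero, Complex.zero_im, zero_div]
  have h3 : inner ℝ (rotField g q) (horizNormal g q) = ‖horizNormal g q‖ ^ 2 := by
    rw [inner_rotField_horizNormal hρ, norm_horizNormal_sq hq]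
  rw [inner_add_left, inner_add_left, real_inner_smul_left, real_inner_smul_left, real_inner_smul_left,
    h1, h2, h3, mul_zero, mul_zero, zero_add, add_zero]
  have := norm_horizNormal_sq_of_page (g := g) hc hw
  linear_combination b * this

end Summit.SmoothPoincare4.SmoothPoincare4.Theorems.AcyclicBisectionExists.ModpBraidOrbits

end
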